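import Summits.CriticalPhenomena.PercolationContinuityZ3.Theorems.PercNearOneGluingNoHeavyLowerTailKnQuestion8CoefficientwiseOffCluster
import HarnessLib

/-!
# The zone flip `P_z` of a two-colouring: an involution exchanging the red and the blue cluster of the conditioning vertex

Support file (`--supports stmt-CriticalPhenomena-4575`, closed), prover `prim-cplus-coupling` (gen 26).  No definitions, no notations, no named
facts, no sorries; standard axioms.  Memo `prim-cplus-coupling/A5-COUPLING-gen26.md` §5 (Theorem K); the reduction theorem itself is in the companion file
`…CoefficientwiseZoneFlipReduction`.

Setting (as in prim-lf-2's `Coefficientwise` files): a finite multigraph with edge set `ι` and end-point map `ends : ι → Sym2 V`; a colouring is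
`s : Finset ι` (the red edges; `sᶜ` the blue ones); `C_v(s) = openCluster (ends '' s) v` is the red vertex cluster of `v`.
THE ZONE FLIP.  For a colouring `s` let `Q(s)` be the set of edges meeting the 'zone' `C_z(s) ∪ C_z(sᶜ)` of the vertex `z` (its red cluster
together with its blue cluster) and `P_z(s) := s ∆ Q(s)` (recolour every edge at the zone).  This file proves:
* `Coefficientwise.openCluster_zoneFlip` — `C_z(P_z s) = C_z(sᶜ)`: the flip exchanges the red and the blue cluster of `z` (a flipped-red edge at a
  vertex of `C_z(sᶜ)` lies at the zone, hence was blue, hence has both ends in `C_z(sᶜ)`; conversely every blue edge inside `C_z(sᶜ)` is flipped);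
  `Coefficientwise.openCluster_zoneFlip_compl` — `C_z((P_z s)ᶜ) = C_z(s)`; hence `Coefficientwise.zoneEdges_zoneFlip` (`Q(P_z s) = Q(s)`),
  `Coefficientwise.zoneFlip_zoneFlip` (`P_z` is an involution) and `Coefficientwise.zoneFlip_mem` (`P_z` preserves the two-sided disconnection
  `{z ∉ C_x(s)} ∩ {z ∉ C_x(sᶜ)}`, because `z ∈ C_x(P_z s)` would put `x` in `C_z(P_z s) = C_z(sᶜ)`);
* `Coefficientwise.zone_locality` — a colouring agreeing with `s₀` on `Q(s₀)` has the same two clusters of `z` (walk transfer), so the two-sided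
  event is a disjoint union of CELLS `{t | t ∩ Q(s₀) = s₀ ∩ Q(s₀)}`;
* `Coefficientwise.cell_sum_mul_flip_le` — Harris on a cell for a cross term: `Σ_{cell} Φ(t)·G(π ∪ (tᶜ∖B)) ≤ Σ_{cell} Φ(t)·G(t)` for monotone `Φ, G`
  and `π ⊆ B` (`t ↦ π ∪ (tᶜ ∖ B)` is the flip of the free coordinates; prim-lf-2's `fkg_cell` applied to `(Φ, G)` and to `(Φ, M − G∘flip)`).
[cite: KozmaNitzan2024, Questions 8–9 (§5.5 p. 36) (context: the Question-8 pocket covariance programme)]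
-/

namespace Summit.CriticalPhenomena.PercolationContinuityZ3.Theorems

open Finset Literature.Probability.Percolation

namespace Coefficientwise

variable {ι V : Type*}

/-- A red edge at a vertex of the red cluster of `z` has both ends in that cluster. [cite: KozmaNitzan2024, §5.5 (context only)] -/
theorem mem_openCluster_of_mem_ends (ends : ι → Sym2 V) (s : Finset ι) (z : V) {i : ι} (hi : i ∈ s)
    {v w : V} (hv : v ∈ openCluster (ends '' (↑s : Set ι)) z) (hvi : v ∈ ends i) (hwi : w ∈ ends i) :
    w ∈ openCluster (ends '' (↑s : Set ι)) z := by
  by_cases hvw : v = w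
  · subst hvw; exact hv
  · have he : ends i = s(v, w) := (Sym2.mem_and_mem_iff hvw).mp ⟨hvi, hwi⟩
    have hadj : (openGraph (ends '' (↑s : Set ι))).Adj v w := by
      rw [openGraph_image_adj]
      exact ⟨⟨i, hi, he⟩, hvw⟩
    exact SimpleGraph.Reachable.trans hv hadj.reachable

/-- Two colourings that agree on every edge at the red cluster `C_z(s₀)` have the same red cluster of `z` (walk transfer inside the cluster).
[cite: KozmaNitzan2024, §5.5 (context only)] -/
theorem openCluster_eq_of_agree (ends : ι → Sym2 V) (z : V) (s₀ t : Finset ι)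
    (hagree : ∀ i, (∃ v, v ∈ openCluster (ends '' (↑s₀ : Set ι)) z ∧ v ∈ ends i) → (i ∈ t ↔ i ∈ s₀)) :
    openCluster (ends '' (↑t : Set ι)) z = openCluster (ends '' (↑s₀ : Set ι)) z := by
  set Z₀ : Set V := openCluster (ends '' (↑s₀ : Set ι)) z with hZ₀
  have h1 : ∀ u ∈ Z₀, ∀ w, (openGraph (ends '' (↑s₀ : Set ι))).Adj u w →
      (openGraph (ends '' (↑t : Set ι))).Adj u w ∧ w ∈ Z₀ := by
    intro u hu w hadj
    have hadj0 := hadj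
    rw [openGraph_image_adj] at hadj
    obtain ⟨⟨i, his, hi⟩, hne⟩ := hadj
    have hui : u ∈ ends i := by rw [hi]; exact Sym2.mem_mk_left u w
    refine ⟨?_, SimpleGraph.Reachable.trans hu hadj0.reachable⟩
    rw [openGraph_image_adj]
    exact ⟨⟨i, (hagree i ⟨u, hu, hui⟩).mpr his, hi⟩, hne⟩
  have h2 : ∀ u ∈ Z₀, ∀ w, (openGraph (ends '' (↑t : Set ι))).Adj u w →
      (openGraph (ends '' (↑s₀ : Set ι))).Adj u w ∧ w ∈ Z₀ := by
    intro u hu w hadj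
    rw [openGraph_image_adj] at hadj
    obtain ⟨⟨i, hit, hi⟩, hne⟩ := hadj
    have hui : u ∈ ends i := by rw [hi]; exact Sym2.mem_mk_left u w
    have hadj' : (openGraph (ends '' (↑s₀ : Set ι))).Adj u w := by
      rw [openGraph_image_adj]
      exact ⟨⟨i, (hagree i ⟨u, hu, hui⟩).mp hit, hi⟩, hne⟩
    exact ⟨hadj', SimpleGraph.Reachable.trans hu hadj'.reachable⟩
  have hz : z ∈ Z₀ := mem_openCluster_self _ z
  ext y
  constructor
  · rintro ⟨p⟩; exact ((reachable_transfer Z₀ h2 p) hz).2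
  · rintro ⟨p⟩; exact ((reachable_transfer Z₀ h1 p) hz).1

variable [Fintype ι] [DecidableEq ι]
variable (ends : ι → Sym2 V) (z : V)




open Classical in
/-- The zone of `sᶜ` is the zone of `s`. [this work] -/
theorem zoneEdges_compl (s : Finset ι) : (Finset.univ.filter (fun i : ι => ∃ v, (v ∈ (openCluster (ends '' (↑(sᶜ) : Set ι)) (z)) ∨ v ∈ (openCluster (ends '' (↑((sᶜ)ᶜ) : Set ι)) (z))) ∧ v ∈ ends i)) = (Finset.univ.filter (fun i : ι => ∃ v, (v ∈ (openCluster (ends '' (↑(s) : Set ι)) (z)) ∨ v ∈ (openCluster (ends '' (↑((s)ᶜ) : Set ι)) (z))) ∧ v ∈ ends i)) := by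
  ext i
  simp only [Finset.mem_filter, Finset.mem_univ, true_and, compl_compl]
  constructor
  · rintro ⟨v, hv, hvi⟩; exact ⟨v, hv.symm, hvi⟩
  · rintro ⟨v, hv, hvi⟩; exact ⟨v, hv.symm, hvi⟩

open Classical in
/-- **The zone flip exchanges the two clusters of `z`**: `C_z(P_z s) = C_z(sᶜ)`.  (A flipped-red edge at a vertex of `C_z(sᶜ)` lies at the zone, hence
was blue, hence has both ends in `C_z(sᶜ)`; conversely every blue edge inside `C_z(sᶜ)` is flipped to red.) [this work] -/
theorem openCluster_zoneFlip (s : Finset ι) : (openCluster (ends '' (↑((symmDiff (s) (Finset.univ.filter (fun i : ι => ∃ v, (v ∈ (openCluster (ends '' (↑(s) : Set ι)) (z)) ∨ v ∈ (openCluster (ends '' (↑((s)ᶜ) : Set ι)) (z))) ∧ v ∈ ends i)))) : Set ι)) (z)) = (openCluster (ends '' (↑(sᶜ) : Set ι)) (z)) := by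
  set Q := (Finset.univ.filter (fun i : ι => ∃ v, (v ∈ (openCluster (ends '' (↑(s) : Set ι)) (z)) ∨ v ∈ (openCluster (ends '' (↑((s)ᶜ) : Set ι)) (z))) ∧ v ∈ ends i)) with hQ
  set ZB : Set V := (openCluster (ends '' (↑(sᶜ) : Set ι)) (z)) with hZB
  have mem_Q : ∀ i, i ∈ Q ↔ ∃ v, (v ∈ (openCluster (ends '' (↑(s) : Set ι)) (z)) ∨ v ∈ ZB) ∧ v ∈ ends i := fun i => by
    simp [hQ, hZB]
  have h1 : ∀ u ∈ ZB, ∀ w, (openGraph (ends '' (↑(symmDiff s Q) : Set ι))).Adj u w →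
      (openGraph (ends '' (↑(sᶜ) : Set ι))).Adj u w ∧ w ∈ ZB := by
    intro u hu w hadj
    rw [openGraph_image_adj] at hadj
    obtain ⟨⟨i, hiP, hi⟩, hne⟩ := hadj
    have hui : u ∈ ends i := by rw [hi]; exact Sym2.mem_mk_left u w
    have hwi : w ∈ ends i := by rw [hi]; exact Sym2.mem_mk_right u w
    have hiQ : i ∈ Q := (mem_Q i).mpr ⟨u, Or.inr hu, hui⟩
    have his : i ∉ s := by
      rw [Finset.mem_symmDiff] at hiP
      rcases hiP with ⟨_, hnQ⟩ | ⟨_, hns⟩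
      · exact absurd hiQ hnQ
      · exact hns
    have hisc : i ∈ sᶜ := Finset.mem_compl.mpr his
    have hadj' : (openGraph (ends '' (↑(sᶜ) : Set ι))).Adj u w := by
      rw [openGraph_image_adj]; exact ⟨⟨i, hisc, hi⟩, hne⟩
    exact ⟨hadj', mem_openCluster_of_mem_ends ends sᶜ z hisc hu hui hwi⟩
  have h2 : ∀ u ∈ ZB, ∀ w, (openGraph (ends '' (↑(sᶜ) : Set ι))).Adj u w →
      (openGraph (ends '' (↑(symmDiff s Q) : Set ι))).Adj u w ∧ w ∈ ZB := by
    intro u hu w hadj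
    rw [openGraph_image_adj] at hadj
    obtain ⟨⟨i, hisc, hi⟩, hne⟩ := hadj
    have hui : u ∈ ends i := by rw [hi]; exact Sym2.mem_mk_left u w
    have hwi : w ∈ ends i := by rw [hi]; exact Sym2.mem_mk_right u w
    have hiQ : i ∈ Q := (mem_Q i).mpr ⟨u, Or.inr hu, hui⟩
    have his : i ∉ s := Finset.mem_compl.mp hisc
    have hiP : i ∈ symmDiff s Q := Finset.mem_symmDiff.mpr (Or.inr ⟨hiQ, his⟩)
    refine ⟨?_, mem_openCluster_of_mem_ends ends sᶜ z hisc hu hui hwi⟩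
    rw [openGraph_image_adj]; exact ⟨⟨i, hiP, hi⟩, hne⟩
  have hz : z ∈ ZB := mem_openCluster_self _ z
  ext y
  constructor
  · rintro ⟨p⟩; exact ((reachable_transfer ZB h1 p) hz).2
  · rintro ⟨p⟩; exact ((reachable_transfer ZB h2 p) hz).1

open Classical in
/-- The complement of the flipped colouring is the flip of the complement: `(P_z s)ᶜ = P_z (sᶜ)`. [this work] -/
theorem compl_zoneFlip (s : Finset ι) : ((symmDiff (s) (Finset.univ.filter (fun i : ι => ∃ v, (v ∈ (openCluster (ends '' (↑(s) : Set ι)) (z)) ∨ v ∈ (openCluster (ends '' (↑((s)ᶜ) : Set ι)) (z))) ∧ v ∈ ends i))))ᶜ = (symmDiff (sᶜ) (Finset.univ.filter (fun i : ι => ∃ v, (v ∈ (openCluster (ends '' (↑(sᶜ) : Set ι)) (z)) ∨ v ∈ (openCluster (ends '' (↑((sᶜ)ᶜ) : Set ι)) (z))) ∧ v ∈ ends i))) := by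
  rw [zoneEdges_compl]
  ext i
  simp only [Finset.mem_compl, Finset.mem_symmDiff]
  tauto

open Classical in
/-- The blue cluster of `z` after the flip is its old red cluster: `C_z((P_z s)ᶜ) = C_z(s)`. [this work] -/
theorem openCluster_zoneFlip_compl (s : Finset ι) : (openCluster (ends '' (↑(((symmDiff (s) (Finset.univ.filter (fun i : ι => ∃ v, (v ∈ (openCluster (ends '' (↑(s) : Set ι)) (z)) ∨ v ∈ (openCluster (ends '' (↑((s)ᶜ) : Set ι)) (z))) ∧ v ∈ ends i))))ᶜ) : Set ι)) (z)) = (openCluster (ends '' (↑(s) : Set ι)) (z)) := by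
  rw [compl_zoneFlip]
  have h := openCluster_zoneFlip ends z sᶜ
  simp only [compl_compl] at h ⊢
  exact h

open Classical in
/-- The zone is invariant under the flip: `Q(P_z s) = Q(s)`. [this work] -/
theorem zoneEdges_zoneFlip (s : Finset ι) : (Finset.univ.filter (fun i : ι => ∃ v, (v ∈ (openCluster (ends '' (↑((symmDiff (s) (Finset.univ.filter (fun i : ι => ∃ v, (v ∈ (openCluster (ends '' (↑(s) : Set ι)) (z)) ∨ v ∈ (openCluster (ends '' (↑((s)ᶜ) : Set ι)) (z))) ∧ v ∈ ends i)))) : Set ι)) (z)) ∨ v ∈ (openCluster (ends '' (↑(((symmDiff (s) (Finset.univ.filter (fun i : ι => ∃ v, (v ∈ (openCluster (ends '' (↑(s) : Set ι)) (z)) ∨ v ∈ (openCluster (ends '' (↑((s)ᶜ) : Set ι)) (z))) ∧ v ∈ ends i))))ᶜ) : Set ι)) (z))) ∧ v ∈ ends i)) = (Finset.univ.filter (fun i : ι => ∃ v, (v ∈ (openCluster (ends '' (↑(s) : Set ι)) (z)) ∨ v ∈ (openCluster (ends '' (↑((s)ᶜ) : Set ι)) (z))) ∧ v ∈ ends i))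 := by
  ext i
  simp only [Finset.mem_filter, Finset.mem_univ, true_and]
  rw [openCluster_zoneFlip, openCluster_zoneFlip_compl]
  constructor
  · rintro ⟨v, hv, hvi⟩; exact ⟨v, hv.symm, hvi⟩
  · rintro ⟨v, hv, hvi⟩; exact ⟨v, hv.symm, hvi⟩

open Classical in
/-- **`P_z` is an involution.** [this work] -/
theorem zoneFlip_zoneFlip (s : Finset ι) : (symmDiff ((symmDiff (s) (Finset.univ.filter (fun i : ι => ∃ v, (v ∈ (openCluster (ends '' (↑(s) : Set ι)) (z)) ∨ v ∈ (openCluster (ends '' (↑((s)ᶜ) : Set ι)) (z))) ∧ v ∈ ends i)))) (Finset.univ.filter (fun i : ι => ∃ v, (v ∈ (openCluster (ends '' (↑((symmDiff (s) (Finset.univ.filter (fun i : ι => ∃ v, (v ∈ (openCluster (ends '' (↑(s) : Set ι)) (z)) ∨ v ∈ (openCluster (ends '' (↑((s)ᶜ) : Set ι)) (z))) ∧ v ∈ ends i)))) : Set ι)) (z)) ∨ v ∈ (openCluster (ends '' (↑(((symmDiff (s) (Finset.univ.filter (fun i : ι => ∃ v, (v ∈ (openCluster (ends '' (↑(s) :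 Set ι)) (z)) ∨ v ∈ (openCluster (ends '' (↑((s)ᶜ) : Set ι)) (z))) ∧ v ∈ ends i))))ᶜ) : Set ι)) (z))) ∧ v ∈ ends i))) = s := by
  rw [zoneEdges_zoneFlip]
  exact symmDiff_symmDiff_cancel_right _ _

open Classical in
/-- **`P_z` preserves the two-sided disconnection** `S = {z ∉ C_x(s)} ∩ {z ∉ C_x(sᶜ)}`. [this work] -/
theorem zoneFlip_mem (x : V) (s : Finset ι) (h1 : z ∉ (openCluster (ends '' (↑(s) : Set ι)) (x))) (h2 : z ∉ (openCluster (ends '' (↑(sᶜ) : Set ι)) (x))) :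
    z ∉ (openCluster (ends '' (↑((symmDiff (s) (Finset.univ.filter (fun i : ι => ∃ v, (v ∈ (openCluster (ends '' (↑(s) : Set ι)) (z)) ∨ v ∈ (openCluster (ends '' (↑((s)ᶜ) : Set ι)) (z))) ∧ v ∈ ends i)))) : Set ι)) (x)) ∧ z ∉ (openCluster (ends '' (↑(((symmDiff (s) (Finset.univ.filter (fun i : ι => ∃ v, (v ∈ (openCluster (ends '' (↑(s) : Set ι)) (z)) ∨ v ∈ (openCluster (ends '' (↑((s)ᶜ) : Set ι)) (z))) ∧ v ∈ ends i))))ᶜ) : Set ι)) (x)) := by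
  constructor
  · intro hz
    have hx : x ∈ (openCluster (ends '' (↑((symmDiff (s) (Finset.univ.filter (fun i : ι => ∃ v, (v ∈ (openCluster (ends '' (↑(s) : Set ι)) (z)) ∨ v ∈ (openCluster (ends '' (↑((s)ᶜ) : Set ι)) (z))) ∧ v ∈ ends i)))) : Set ι)) (z)) := SimpleGraph.Reachable.symm hz
    rw [openCluster_zoneFlip] at hx
    exact h2 (SimpleGraph.Reachable.symm hx)
  · intro hz
    have hx : x ∈ (openCluster (ends '' (↑(((symmDiff (s) (Finset.univ.filter (fun i : ι => ∃ v, (v ∈ (openCluster (ends '' (↑(s) : Set ι)) (z)) ∨ v ∈ (openCluster (ends '' (↑((s)ᶜ) : Set ι)) (z))) ∧ v ∈ ends i))))ᶜ) : Set ι)) (z)) := SimpleGraph.Reachable.symm hz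
    rw [openCluster_zoneFlip_compl] at hx
    exact h1 (SimpleGraph.Reachable.symm hx)

open Classical in
/-- **Locality of the zone.**  A colouring `t` agreeing with `s₀` on the edges at the zone of `s₀` has the same red and blue clusters of `z`
(hence the same zone). [this work] -/
theorem zone_locality (s₀ t : Finset ι) (ht : t ∩ (Finset.univ.filter (fun i : ι => ∃ v, (v ∈ (openCluster (ends '' (↑(s₀) : Set ι)) (z)) ∨ v ∈ (openCluster (ends '' (↑((s₀)ᶜ) : Set ι)) (z))) ∧ v ∈ ends i)) = s₀ ∩ (Finset.univ.filter (fun i : ι => ∃ v, (v ∈ (openCluster (ends '' (↑(s₀) : Set ι)) (z)) ∨ v ∈ (openCluster (ends '' (↑((s₀)ᶜ) : Set ι)) (z))) ∧ v ∈ ends i))) :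
    (openCluster (ends '' (↑(t) : Set ι)) (z)) = (openCluster (ends '' (↑(s₀) : Set ι)) (z)) ∧ (openCluster (ends '' (↑(tᶜ) : Set ι)) (z)) = (openCluster (ends '' (↑(s₀ᶜ) : Set ι)) (z)) := by
  have agree : ∀ i, i ∈ (Finset.univ.filter (fun i : ι => ∃ v, (v ∈ (openCluster (ends '' (↑(s₀) : Set ι)) (z)) ∨ v ∈ (openCluster (ends '' (↑((s₀)ᶜ) : Set ι)) (z))) ∧ v ∈ ends i)) → (i ∈ t ↔ i ∈ s₀) := by
    intro i hi
    have := congrArg (fun u : Finset ι => i ∈ u) ht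
    simp only [Finset.mem_inter, hi, and_true, eq_iff_iff] at this
    exact this
  have memQ : ∀ i v, (v ∈ (openCluster (ends '' (↑(s₀) : Set ι)) (z)) ∨ v ∈ (openCluster (ends '' (↑(s₀ᶜ) : Set ι)) (z))) → v ∈ ends i → i ∈ (Finset.univ.filter (fun i : ι => ∃ v, (v ∈ (openCluster (ends '' (↑(s₀) : Set ι)) (z)) ∨ v ∈ (openCluster (ends '' (↑((s₀)ᶜ) : Set ι)) (z))) ∧ v ∈ ends i)) := by
    intro i v hv hvi
    simp only [Finset.mem_filter, Finset.mem_univ, true_and]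
    exact ⟨v, hv, hvi⟩
  constructor
  · refine openCluster_eq_of_agree ends z s₀ t ?_
    rintro i ⟨v, hv, hvi⟩
    exact agree i (memQ i v (Or.inl hv) hvi)
  · refine openCluster_eq_of_agree ends z s₀ᶜ tᶜ ?_
    rintro i ⟨v, hv, hvi⟩
    have := agree i (memQ i v (Or.inr hv) hvi)
    rw [Finset.mem_compl, Finset.mem_compl]
    tauto

omit [DecidableEq ι] in
/-- **Harris on a cell, cross form.**  For `π ⊆ B` and monotone `Φ, G : Finset ι → ℝ`, on the cell `{t | t ∩ B = π}`
`Σ Φ(t)·G(π ∪ (tᶜ ∖ B)) ≤ Σ Φ(t)·G(t)` — `t ↦ π ∪ (tᶜ ∖ B)` being the flip of the free coordinates.  (prim-lf-2's `fkg_cell` for `(Φ, G)` and for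
`(Φ, M − G∘flip)`.) [cite: KozmaNitzan2024, §5.5 (context only; the inequality is Harris/FKG on a sublattice)] -/
theorem cell_sum_mul_flip_le [DecidableEq ι] (B π : Finset ι) (hπ : π ⊆ B) (Φ G : Finset ι → ℝ) (hΦ : Monotone Φ) (hG : Monotone G) :
    ∑ t ∈ univ.filter (fun t : Finset ι => t ∩ B = π), Φ t * G (π ∪ (tᶜ \ B)) ≤
      ∑ t ∈ univ.filter (fun t : Finset ι => t ∩ B = π), Φ t * G t := by
  set cell := univ.filter (fun t : Finset ι => t ∩ B = π) with hcell
  have mem_cell : ∀ t : Finset ι, t ∈ cell ↔ t ∩ B = π := fun t => by simp [hcell]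
  set τ : Finset ι → Finset ι := fun t => π ∪ (tᶜ \ B) with hτ
  have facts : ∀ t : Finset ι, t ∩ B = π → ∀ i, (i ∈ π ↔ i ∈ t ∧ i ∈ B) := fun t ht i => by
    rw [← ht]; exact Finset.mem_inter
  have memτ : ∀ t i, i ∈ τ t ↔ i ∈ π ∨ (i ∉ t ∧ i ∉ B) := fun t i => by
    simp only [hτ, Finset.mem_union, Finset.mem_sdiff, Finset.mem_compl]
  have hτcell : ∀ t, t ∩ B = π → τ t ∩ B = π := by
    intro t ht
    ext i
    simp only [Finset.mem_inter, memτ]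
    have h1 := facts t ht i
    have h2 : i ∈ π → i ∈ B := fun h => hπ h
    tauto
  have hττ : ∀ t, t ∩ B = π → τ (τ t) = t := by
    intro t ht
    ext i
    rw [memτ, memτ]
    have h1 := facts t ht i
    have h2 : i ∈ π → i ∈ B := fun h => hπ h
    tauto
  set M : ℝ := G univ with hM
  set G' : Finset ι → ℝ := fun t => M - G (τ t) with hG'
  have hτanti : ∀ s t : Finset ι, s ⊆ t → τ t ⊆ τ s := by
    intro s t hst i hi
    rw [memτ] at hi ⊢
    rcases hi with h | ⟨hit, hiB⟩
    · exact Or.inl h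
    · exact Or.inr ⟨fun his => hit (hst his), hiB⟩
  have hG'm : Monotone G' := by
    intro s t hst
    simp only [hG']
    linarith [hG (hτanti s t hst)]
  have k1 := fkg_cell B π Φ G hΦ hG
  have k2 := fkg_cell B π Φ G' hΦ hG'm
  have reindex : ∀ H : Finset ι → ℝ, ∑ t ∈ cell, H (τ t) = ∑ t ∈ cell, H t := by
    intro H
    refine Finset.sum_bij' (fun t _ => τ t) (fun t _ => τ t) ?_ ?_ ?_ ?_ ?_
    · intro t ht; exact (mem_cell _).mpr (hτcell t ((mem_cell t).mp ht))
    · intro t ht; exact (mem_cell _).mpr (hτcell t ((mem_cell t).mp ht))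
    · intro t ht; exact hττ t ((mem_cell t).mp ht)
    · intro t ht; exact hττ t ((mem_cell t).mp ht)
    · intro t ht; rfl
  have e1 : ∑ t ∈ cell, G' t = (cell.card : ℝ) * M - ∑ t ∈ cell, G t := by
    simp only [hG', Finset.sum_sub_distrib, Finset.sum_const, nsmul_eq_mul]
    rw [reindex G]
  have e2 : ∑ t ∈ cell, Φ t * G' t = M * ∑ t ∈ cell, Φ t - ∑ t ∈ cell, Φ t * G (τ t) := by
    simp only [hG', mul_sub, Finset.sum_sub_distrib]
    rw [Finset.mul_sum]
    refine congrArg₂ (· - ·) (Finset.sum_congr rfl fun s _ => by ring) rfl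
  rw [e1, e2] at k2
  rcases cell.eq_empty_or_nonempty with hce | hne
  · simp [hce]
  · have hcard : (0 : ℝ) < (cell.card : ℝ) := by exact_mod_cast hne.card_pos
    have h3 : (cell.card : ℝ) * ∑ t ∈ cell, Φ t * G (τ t) ≤ (cell.card : ℝ) * ∑ t ∈ cell, Φ t * G t := by
      nlinarith [k1, k2]
    exact le_of_mul_le_mul_left h3 hcard


end Coefficientwise

end Summit.CriticalPhenomena.PercolationContinuityZ3.Theorems
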